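import Summits.AtomisticToContinuum.FouriersLaw.Theorems.JunctionLocalityDefs
import Summits.AtomisticToContinuum.FouriersLaw.Theorems.JunctionLocalityNonBallisticStubColumnFlatGreenKuboAux2
import Summits.AtomisticToContinuum.FouriersLaw.Theorems.BondHeatUncertaintySubdiffusiveBondHeatBathBondReductionDynkin
import Summits.AtomisticToContinuum.FouriersLaw.Theorems.BondHeatUncertaintySubdiffusiveBondHeatSiteEnergyCurrentCovariance
import Summits.AtomisticToContinuum.FouriersLaw.Theorems.PhononMeanFreePathCoherentDephasingWeakCouplingCorrelationDecay
import Summits.AtomisticToContinuum.FouriersLaw.Theorems.BondHeatUncertaintyLightConeBondHeatBondCorrelation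
import Literature.MathematicalPhysics.KineticTheory.ChainReflection
import Mathlib.MeasureTheory.Integral.IntegralEqImproper

/-!
# `NonBallistic` / stub (CF) `stub_columnFlatGreenKubo`: the column-flat Green–Kubo matrix of the open chain

Stub `stub_columnFlatGreenKubo` (label (CF)) of line `contact-current-forgetting` of crux `stmt-AtomisticToContinuum-9127`
(`JunctionLocality.NonBallistic`). For the pinned anharmonic chain `P = pinnedChain ω₂ lam β γ` (all parameters `> 0`),
`T > 0`, `N ≥ 2`, both Langevin baths at `T`, the constructed kernels `κ_t = P.transitionKernel N T T t`, the Gibbs state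
`μ_T = P.gibbsMeasure N T`, the bond currents `j_b` (`bondCurrentAt`), `J = Σ_b j_b` (`totalCurrentObs`) and the
Green–Kubo matrix integrand `M_N(b,b′)(t) = ⟨j_b, κ_t j_{b′}⟩_{μ_T}` (`gkEntry`):

* (i) `corr(J,J)(t) = Σ_{b<N−1} Σ_{b′<N−1} M_N(b,b′)(t)` (`totalCorr`; linearity of `κ_t` on the `κ_t(z,·)`-integrable
  bond currents, `μ_T(J) = 0`, `j_{N−1} ≡ 0`) — `pinnedChain_totalCorr_eq_sum`;
* (ii) for all bonds `b, b′ < N − 1`: `M_N(b,b′) ∈ L¹(0,∞)` (exponential decorrelation at fixed `N`,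
  `pinnedChain_corr_integrableOn`) and `∫₀^∞ M_N(b,b′) = ∫₀^∞ M_N(b,0)` — every ROW of the integrated matrix is
  constant, by induction on `b′` from the ONE-STEP identity `∫₀^∞ M_N(d,a) = ∫₀^∞ M_N(d,b)` for consecutive sites
  `a, b, c` (`pinnedChain_integral_Ioi_gkRow_step`): Dynkin's identity for the split site energy `ẽ_b`
  (`Lẽ_b = j_a − j_b`, parts 1–2) integrated against `j_d ∈ L²(μ_T)` under the invariant law `μ_T`
  (`pinnedChain_integral_mul_act_sub_of_dynkin`) gives `∫₀ʳ (M(d,a) − M(d,b)) = ⟨j_d, κ_r ẽ_b⟩ − ⟨j_d, ẽ_b⟩`; the static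
  term vanishes by momentum parity (`j_d` odd, `ẽ_b` even), the dynamic one tends to `μ_T(j_d) μ_T(ẽ_b) = 0`
  (`pinnedChain_corr_exp_decay`), and both entries are integrable on `(0,∞)`.

Forward-only and fixed-`N`: no detailed balance, no uniqueness hypothesis; true at the harmonic corner.
-/

noncomputable section

open MeasureTheory ProbabilityTheory Set Filter Topology
open scoped NNReal ENNReal BigOperators

namespace Summit.AtomisticToContinuum.FouriersLaw.Theorems.NonBallistic

open Literature.MathematicalPhysics.KineticTheory.HeatConduction
open Literature.MathematicalPhysics.KineticTheory Literature.Probability.Process OscillatorChain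
open Summit.AtomisticToContinuum.FouriersLaw.Theorems.JunctionLocality
open Summit.AtomisticToContinuum.FouriersLaw.Theorems.SubdiffusiveBondHeat
open Summit.AtomisticToContinuum.FouriersLaw.Theorems.CoherentDephasing

variable {N : ℕ}

section Statics

variable {ω₂ lam β γ : ℝ}

/-- `|ẽ_b| ≤ 2 (1 + H)²` (`0 ≤ ẽ_b ≤ 2H`). [folklore] -/
theorem pinnedChain_abs_splitSiteEnergy_le_sq (hω : 0 ≤ ω₂) (hl : 0 ≤ lam) (hβ : 0 ≤ β) (γ : ℝ) {a b c : Fin N}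
    (hab : b.val = a.val + 1) (hbc : c.val = b.val + 1) (y : PhaseSpace N) :
    |(y.2 b) ^ 2 / 2 + (pinnedChain ω₂ lam β γ).U (y.1 b) + (pinnedChain ω₂ lam β γ).V (y.1 c - y.1 b) / 2 +
        (pinnedChain ω₂ lam β γ).V (y.1 b - y.1 a) / 2| ≤ 2 * (1 + (pinnedChain ω₂ lam β γ).hamiltonian N y) ^ 2 := by
  obtain ⟨h0, h1⟩ := pinnedChain_splitSiteEnergy_nonneg_le hω hl hβ γ hab hbc y
  have hH0 := pinnedChain_hamiltonian_nonneg hω hl hβ γ N y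
  rw [abs_of_nonneg h0]
  nlinarith

/-- `|ẽ_b| ≤ (4e^ϑ/ϑ²) e^{ϑH}` for every `ϑ > 0`: the split site energy is an observable of exponential class.
[folklore] -/
theorem pinnedChain_abs_splitSiteEnergy_le_exp (hω : 0 ≤ ω₂) (hl : 0 ≤ lam) (hβ : 0 ≤ β) (γ : ℝ) {a b c : Fin N}
    (hab : b.val = a.val + 1) (hbc : c.val = b.val + 1) {ϑ : ℝ} (hϑ : 0 < ϑ) (y : PhaseSpace N) :
    |(y.2 b) ^ 2 / 2 + (pinnedChain ω₂ lam β γ).U (y.1 b) + (pinnedChain ω₂ lam β γ).V (y.1 c - y.1 b) / 2 +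
        (pinnedChain ω₂ lam β γ).V (y.1 b - y.1 a) / 2| ≤
      (2 * (2 * Real.exp ϑ / ϑ ^ 2)) * Real.exp (ϑ * (pinnedChain ω₂ lam β γ).hamiltonian N y) := by
  have h := pinnedChain_abs_splitSiteEnergy_le_sq hω hl hβ γ hab hbc y
  have hH0 := pinnedChain_hamiltonian_nonneg hω hl hβ γ N y
  have hsq := one_add_sq_le_exp hH0 hϑ
  calc _ ≤ 2 * (1 + (pinnedChain ω₂ lam β γ).hamiltonian N y) ^ 2 := h
    _ ≤ 2 * (2 * Real.exp ϑ / ϑ ^ 2 * Real.exp (ϑ * (pinnedChain ω₂ lam β γ).hamiltonian N y)) :=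
        mul_le_mul_of_nonneg_left hsq (by norm_num)
    _ = _ := by ring

/-- `ẽ_b² ∈ L¹(μ_T)` (`ω₂ > 0`, `lam, β ≥ 0`, `T > 0`). [folklore] -/
theorem pinnedChain_integrable_sq_splitSiteEnergy (hω : 0 < ω₂) (hl : 0 ≤ lam) (hβ : 0 ≤ β) (γ : ℝ) {T : ℝ}
    (hT : 0 < T) {a b c : Fin N} (hab : b.val = a.val + 1) (hbc : c.val = b.val + 1) :
    Integrable (fun y : PhaseSpace N => ((y.2 b) ^ 2 / 2 + (pinnedChain ω₂ lam β γ).U (y.1 b) +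
        (pinnedChain ω₂ lam β γ).V (y.1 c - y.1 b) / 2 + (pinnedChain ω₂ lam β γ).V (y.1 b - y.1 a) / 2) ^ 2)
      ((pinnedChain ω₂ lam β γ).gibbsMeasure N T) :=
  pinnedChain_integrable_sq_of_abs_le hω hl hβ γ N hT (pinnedChain_continuous_splitSiteEnergy ω₂ lam β γ a b c)
    (C := 2) fun y => pinnedChain_abs_splitSiteEnergy_le_sq hω.le hl hβ γ hab hbc y

/-- `(j_a - j_b)² ∈ L¹(μ_T)`. [folklore] -/
theorem pinnedChain_integrable_sq_bondCurrent_sub (hω : 0 < ω₂) (hl : 0 ≤ lam) (hβ : 0 ≤ β) (γ : ℝ) {T : ℝ}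
    (hT : 0 < T) (a b : Fin N) :
    Integrable (fun y : PhaseSpace N => ((pinnedChain ω₂ lam β γ).bondCurrent N a y -
        (pinnedChain ω₂ lam β γ).bondCurrent N b y) ^ 2) ((pinnedChain ω₂ lam β γ).gibbsMeasure N T) := by
  refine pinnedChain_integrable_sq_of_abs_le hω hl hβ γ N hT
    ((pinnedChain_continuous_bondCurrent ω₂ lam β γ N a).sub (pinnedChain_continuous_bondCurrent ω₂ lam β γ N b))
    (C := N * ((3 + β) / 2) + N * ((3 + β) / 2)) fun y => ?_
  have hja := pinnedChain_abs_bondCurrent_le hω.le hl hβ γ N a y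
  have hjb := pinnedChain_abs_bondCurrent_le hω.le hl hβ γ N b y
  calc |(pinnedChain ω₂ lam β γ).bondCurrent N a y - (pinnedChain ω₂ lam β γ).bondCurrent N b y|
      ≤ |(pinnedChain ω₂ lam β γ).bondCurrent N a y| + |(pinnedChain ω₂ lam β γ).bondCurrent N b y| := abs_sub _ _
    _ ≤ N * ((3 + β) / 2 * (1 + (pinnedChain ω₂ lam β γ).hamiltonian N y) ^ 2) +
        N * ((3 + β) / 2 * (1 + (pinnedChain ω₂ lam β γ).hamiltonian N y) ^ 2) := add_le_add hja hjb
    _ = (N * ((3 + β) / 2) + N * ((3 + β) / 2)) * (1 + (pinnedChain ω₂ lam β γ).hamiltonian N y) ^ 2 := by ring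

/-- **Parity**: `∫ j_d ẽ_b dμ_T = 0` (the bond current is odd and the split site energy even under momentum
reversal, which preserves `e^{-H/T} dq dp`; an identity of Bochner integrals, no integrability needed). [folklore] -/
theorem pinnedChain_integral_bondCurrent_mul_splitSiteEnergy (ω₂ lam β γ : ℝ) (N : ℕ) (T : ℝ) (d a b c : Fin N) :
    ∫ z, (pinnedChain ω₂ lam β γ).bondCurrent N d z * ((z.2 b) ^ 2 / 2 + (pinnedChain ω₂ lam β γ).U (z.1 b) +
        (pinnedChain ω₂ lam β γ).V (z.1 c - z.1 b) / 2 + (pinnedChain ω₂ lam β γ).V (z.1 b - z.1 a) / 2)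
      ∂((pinnedChain ω₂ lam β γ).gibbsMeasure N T) = 0 := by
  rw [(pinnedChain ω₂ lam β γ).integral_gibbsMeasure]
  have h := pinnedChain_integral_even_mul_bondCurrent_mul_gibbsDensity ω₂ lam β γ N T d
    (E := fun z : PhaseSpace N => (z.2 b) ^ 2 / 2 + (pinnedChain ω₂ lam β γ).U (z.1 b) +
      (pinnedChain ω₂ lam β γ).V (z.1 c - z.1 b) / 2 + (pinnedChain ω₂ lam β γ).V (z.1 b - z.1 a) / 2)
    (fun x => by simp)
  have h' : ∫ x, (pinnedChain ω₂ lam β γ).bondCurrent N d x * ((x.2 b) ^ 2 / 2 + (pinnedChain ω₂ lam β γ).U (x.1 b) +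
      (pinnedChain ω₂ lam β γ).V (x.1 c - x.1 b) / 2 + (pinnedChain ω₂ lam β γ).V (x.1 b - x.1 a) / 2) *
      (pinnedChain ω₂ lam β γ).gibbsDensity N T x = 0 := by
    rw [← h]
    refine integral_congr_ae (Eventually.of_forall fun x => ?_)
    ring
  rw [h', mul_zero]

end Statics

section RowStep

/-- **One step along a row of the integrated Green–Kubo matrix** (forward-only; fixed `N`): for the pinned chain
(`ω₂, β, γ > 0`, `lam ≥ 0`), equal bath temperatures `T > 0`, a bond current `j_d` and three consecutive sites
`a, b, c`: `∫₀^∞ ∫ j_d · (P_t j_a) dμ_T dt = ∫₀^∞ ∫ j_d · (P_t j_b) dμ_T dt` (Dynkin for `ẽ_b` integrated against `j_d`,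
parity, exponential decorrelation; see the module docstring). [folklore] -/
theorem pinnedChain_integral_Ioi_gkRow_step :
    ∀ {ω₂ lam β γ : ℝ}, 0 < ω₂ → 0 ≤ lam → 0 < β → 0 < γ → ∀ {N : ℕ} {T : ℝ}, 0 < T →
      ∀ (d a b c : Fin N), b.val = a.val + 1 → c.val = b.val + 1 →
        ∫ t in Set.Ioi (0 : ℝ), ∫ z, (pinnedChain ω₂ lam β γ).bondCurrent N d z *
            (∫ y, (pinnedChain ω₂ lam β γ).bondCurrent N a y
              ∂((pinnedChain ω₂ lam β γ).transitionKernel N T T t.toNNReal z))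
          ∂((pinnedChain ω₂ lam β γ).gibbsMeasure N T) =
        ∫ t in Set.Ioi (0 : ℝ), ∫ z, (pinnedChain ω₂ lam β γ).bondCurrent N d z *
            (∫ y, (pinnedChain ω₂ lam β γ).bondCurrent N b y
              ∂((pinnedChain ω₂ lam β γ).transitionKernel N T T t.toNNReal z))
          ∂((pinnedChain ω₂ lam β γ).gibbsMeasure N T) := by
  intro ω₂ lam β γ hω hl hβ hγ N T hT d a b c hab hbc
  obtain ⟨hϑ0, h2ϑ⟩ := LightConeBondHeat.quarter_inv_temp_admissible hT
  set ϑ : ℝ := 1 / (4 * T) with hϑ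
  have hϑ1 : ϑ < 1 / T := by linarith
  set P := pinnedChain ω₂ lam β γ with hP
  set μ := P.gibbsMeasure N T with hμ
  set κ : ℝ → Kernel (PhaseSpace N) (PhaseSpace N) := fun u => P.transitionKernel N T T u.toNNReal with hκ
  have hN : 0 < N := by have := c.isLt; omega
  haveI : IsProbabilityMeasure μ := pinnedChain_isProbabilityMeasure_gibbsMeasure hω hl hβ.le γ N hT
  -- observables
  set e : PhaseSpace N → ℝ := fun y => (y.2 b) ^ 2 / 2 + P.U (y.1 b) + P.V (y.1 c - y.1 b) / 2 +
    P.V (y.1 b - y.1 a) / 2 with he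
  set ℓ : PhaseSpace N → ℝ := fun y => P.bondCurrent N a y - P.bondCurrent N b y with hℓ
  have hjc : ∀ i, Continuous (P.bondCurrent N i) := fun i => pinnedChain_continuous_bondCurrent ω₂ lam β γ N i
  have hec : Continuous e := pinnedChain_continuous_splitSiteEnergy ω₂ lam β γ a b c
  have hℓc : Continuous ℓ := (hjc a).sub (hjc b)
  -- exponential bounds and means
  have hjb : ∀ i y, |P.bondCurrent N i y| ≤ (N * ((3 + β) / 2) * (2 * Real.exp ϑ / ϑ ^ 2)) *
      Real.exp (ϑ * P.hamiltonian N y) := fun i y =>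
    LightConeBondHeat.pinnedChain_abs_bondCurrent_le_exp hω.le hl hβ.le γ N hϑ0 i y
  have heb : ∀ y, |e y| ≤ (2 * (2 * Real.exp ϑ / ϑ ^ 2)) * Real.exp (ϑ * P.hamiltonian N y) := fun y =>
    pinnedChain_abs_splitSiteEnergy_le_exp hω.le hl hβ.le γ hab hbc hϑ0 y
  have hjmean : ∀ i, ∫ z, P.bondCurrent N i z ∂μ = 0 := fun i =>
    pinnedChain_integral_bondCurrent_gibbsMeasure ω₂ lam β γ N T i
  -- the two entries and their integrability on `(0, ∞)`
  set Ma : ℝ → ℝ := fun t => ∫ z, P.bondCurrent N d z * (∫ y, P.bondCurrent N a y ∂(κ t z)) ∂μ with hMa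
  set Mb : ℝ → ℝ := fun t => ∫ z, P.bondCurrent N d z * (∫ y, P.bondCurrent N b y ∂(κ t z)) ∂μ with hMb
  have hIa : IntegrableOn Ma (Ioi 0) :=
    pinnedChain_corr_integrableOn hω hl hβ hγ hN hT hϑ0 h2ϑ (hjc d) (hjc a) (hjb d) (hjb a) (hjmean a)
  have hIb : IntegrableOn Mb (Ioi 0) :=
    pinnedChain_corr_integrableOn hω hl hβ hγ hN hT hϑ0 h2ϑ (hjc d) (hjc b) (hjb d) (hjb b) (hjmean b)
  -- Dynkin's identity for `e`, integrated against `j_d` under the invariant law `μ_T`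
  have hinv : ∀ s : ℝ≥0, μ.bind (P.transitionKernel N T T s) = μ := fun s =>
    pinnedChain_gibbsMeasure_bind_transitionKernel hω hl hβ.le hγ.le hN hT s
  have hf2 : Integrable (fun y => P.bondCurrent N d y ^ 2) μ := pinnedChain_integrable_sq_bondCurrent hω hl hβ.le γ N hT d
  have he2 : Integrable (fun y => e y ^ 2) μ := pinnedChain_integrable_sq_splitSiteEnergy hω hl hβ.le γ hT hab hbc
  have hℓ2 : Integrable (fun y => ℓ y ^ 2) μ := pinnedChain_integrable_sq_bondCurrent_sub hω hl hβ.le γ hT a b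
  have hdyn : ∀ (r : ℝ≥0) (z : PhaseSpace N), ∫ y, e y ∂(P.transitionKernel N T T r z) - e z =
      ∫ s in (0 : ℝ)..(r : ℝ), ∫ y, ℓ y ∂(P.transitionKernel N T T s.toNNReal z) := fun r z =>
    pinnedChain_splitSiteEnergy_dynkin hω hl hβ hγ hT hab hbc r z
  have hG : ∀ r : ℝ, 0 ≤ r → (∫ y, P.bondCurrent N d y * (∫ y', e y' ∂(κ r y)) ∂μ) -
      ∫ y, P.bondCurrent N d y * e y ∂μ = ∫ s in (0:ℝ)..r, ∫ y, P.bondCurrent N d y * (∫ y', ℓ y' ∂(κ s y)) ∂μ :=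
    fun r hr => pinnedChain_integral_mul_act_sub_of_dynkin hω hl hβ.le hγ.le N T T μ hinv (hjc d).measurable
      hec.measurable hℓc.measurable hf2 he2 hℓ2 hdyn hr
  -- parity
  have hpar : ∫ y, P.bondCurrent N d y * e y ∂μ = 0 :=
    pinnedChain_integral_bondCurrent_mul_splitSiteEnergy ω₂ lam β γ N T d a b c
  -- linearity: `⟨j_d, P_s ℓ⟩ = M(d,a)(s) - M(d,b)(s)`
  have hlin : ∀ s : ℝ, ∫ y, P.bondCurrent N d y * (∫ y', ℓ y' ∂(κ s y)) ∂μ = Ma s - Mb s := by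
    intro s
    have hia : ∀ z, Integrable (P.bondCurrent N a) (κ s z) := fun z => integrable_of_abs_le_exp
      (pinnedChain_integrable_exp_mul_hamiltonian_transitionKernel hω hl hT hβ.le hγ.le hN hϑ0 hϑ1 _ z) (hjc a) (hjb a)
    have hib : ∀ z, Integrable (P.bondCurrent N b) (κ s z) := fun z => integrable_of_abs_le_exp
      (pinnedChain_integrable_exp_mul_hamiltonian_transitionKernel hω hl hT hβ.le hγ.le hN hϑ0 hϑ1 _ z) (hjc b) (hjb b)
    have hinner : ∀ z, ∫ y', ℓ y' ∂(κ s z) = (∫ y', P.bondCurrent N a y' ∂(κ s z)) - ∫ y', P.bondCurrent N b y' ∂(κ s z) :=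
      fun z => integral_sub (hia z) (hib z)
    have hpa : Integrable (fun z => P.bondCurrent N d z * ∫ y, P.bondCurrent N a y ∂(κ s z)) μ :=
      pinnedChain_integrable_weight_mul_act hω hl hβ hγ hN hT hϑ0 h2ϑ (hjc d) (hjc a) (hjb d) (hjb a) s.toNNReal
    have hpb : Integrable (fun z => P.bondCurrent N d z * ∫ y, P.bondCurrent N b y ∂(κ s z)) μ :=
      pinnedChain_integrable_weight_mul_act hω hl hβ hγ hN hT hϑ0 h2ϑ (hjc d) (hjc b) (hjb d) (hjb b) s.toNNReal
    rw [← integral_sub hpa hpb]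
    refine integral_congr_ae (Eventually.of_forall fun z => ?_)
    simp only [hinner z, mul_sub]
  -- hence `∫₀ʳ (M(d,a) - M(d,b)) = ⟨j_d, P_r ẽ⟩`
  have hint_eq : ∀ r : ℝ, 0 ≤ r → ∫ s in (0:ℝ)..r, (Ma s - Mb s) =
      ∫ y, P.bondCurrent N d y * (∫ y', e y' ∂(κ r y)) ∂μ := by
    intro r hr
    have h := hG r hr
    rw [hpar, sub_zero] at h
    rw [h]
    exact intervalIntegral.integral_congr fun s _ => (hlin s).symm
  -- `⟨j_d, P_r ẽ⟩ → 0`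
  obtain ⟨C, c', hc', hdec⟩ := pinnedChain_corr_exp_decay hω hl hβ hγ hN hT hϑ0 h2ϑ (hjc d) hec (hjb d) heb
  have hexp0 : Tendsto (fun r : ℝ => C * Real.exp (-c' * r)) atTop (𝓝 0) := by
    have h1 : Tendsto (fun r : ℝ => Real.exp (-(c' * r))) atTop (𝓝 0) :=
      Real.tendsto_exp_neg_atTop_nhds_zero.comp (Tendsto.const_mul_atTop hc' tendsto_id)
    have h2 := h1.const_mul C
    rw [mul_zero] at h2
    refine h2.congr fun r => ?_
    rw [neg_mul]
  have hlim0 : Tendsto (fun r : ℝ => ∫ y, P.bondCurrent N d y * (∫ y', e y' ∂(κ r y)) ∂μ) atTop (𝓝 0) := by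
    refine squeeze_zero_norm' ?_ hexp0
    filter_upwards [eventually_ge_atTop (0:ℝ)] with r hr
    have h := hdec r hr
    rw [hjmean d, zero_mul, sub_zero] at h
    rw [Real.norm_eq_abs]
    exact h
  -- `∫₀ʳ (M(d,a) - M(d,b)) → ∫_{(0,∞)} (M(d,a) - M(d,b))`
  have hlim1 : Tendsto (fun r : ℝ => ∫ s in (0:ℝ)..r, (Ma s - Mb s)) atTop
      (𝓝 (∫ s in Ioi (0:ℝ), (Ma s - Mb s))) :=
    intervalIntegral_tendsto_integral_Ioi 0 (hIa.sub hIb) tendsto_id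
  have hEq : ∫ s in Ioi (0:ℝ), (Ma s - Mb s) = 0 := by
    refine tendsto_nhds_unique hlim1 ?_
    refine hlim0.congr' ?_
    filter_upwards [eventually_ge_atTop (0:ℝ)] with r hr
    exact (hint_eq r hr).symm
  rw [integral_sub hIa hIb] at hEq
  show ∫ t in Ioi (0:ℝ), Ma t = ∫ t in Ioi (0:ℝ), Mb t
  linarith

end RowStep

section Vocabulary

variable (P : OscillatorChain) (T : ℝ)

/-- For bond indices carried by sites, `M_N(b,b′)(t) = ∫ j_b · (κ_{t⁺} j_{b′}) dμ_T` with the `Fin N`-indexed currents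
`P.bondCurrent`. [folklore] -/
theorem gkEntry_eq_of_lt {b b' : ℕ} (hb : b < N) (hb' : b' < N) :
    gkEntry P N T b b' = fun t => ∫ z, P.bondCurrent N ⟨b, hb⟩ z *
        (∫ y, P.bondCurrent N ⟨b', hb'⟩ y ∂(P.transitionKernel N T T t.toNNReal z)) ∂(P.gibbsMeasure N T) := by
  have h1 : bondCurrentAt P N b = P.bondCurrent N ⟨b, hb⟩ := funext fun z => bondCurrentAt_eq_bondCurrent P hb z
  have h2 : bondCurrentAt P N b' = P.bondCurrent N ⟨b', hb'⟩ := funext fun z => bondCurrentAt_eq_bondCurrent P hb' z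
  funext t
  rw [gkEntry_def, h1, h2]
  rfl

/-- The last site carries no outgoing bond: `bondCurrentAt P (n+1) n ≡ 0`. [folklore] -/
theorem bondCurrentAt_last (n : ℕ) : bondCurrentAt P (n + 1) n = fun _ => 0 := by
  funext z
  rw [bondCurrentAt_eq_bondCurrent P (Nat.lt_succ_self n)]
  exact P.bondCurrent_eq_zero_of_last (n + 1) ⟨n, Nat.lt_succ_self n⟩ rfl z

/-- `M_{n+1}(b, n) ≡ 0` (no current through the non-existent bond `(n, n+1)`). [folklore] -/
theorem gkEntry_last_right (n b : ℕ) (t : ℝ) : gkEntry P (n + 1) T b n t = 0 := by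
  rw [gkEntry_def, bondCurrentAt_last]
  simp [evolve_def]

/-- `M_{n+1}(n, b′) ≡ 0`. [folklore] -/
theorem gkEntry_last_left (n b' : ℕ) (t : ℝ) : gkEntry P (n + 1) T n b' t = 0 := by
  rw [gkEntry_def, bondCurrentAt_last]
  simp

end Vocabulary

section Pinned

variable {ω₂ lam β γ : ℝ}

/-- **(ii), integrability**: every Green–Kubo entry `M_N(b,b′)` with `b, b′ < N` is integrable on `(0,∞)` at fixed `N`
(`μ_T(j_{b′}) = 0` and exponential decorrelation, `pinnedChain_corr_integrableOn`). [folklore] -/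
theorem pinnedChain_integrableOn_gkEntry (hω : 0 < ω₂) (hl : 0 ≤ lam) (hβ : 0 < β) (hγ : 0 < γ) {N : ℕ} {T : ℝ}
    (hT : 0 < T) {b b' : ℕ} (hb : b < N) (hb' : b' < N) :
    IntegrableOn (gkEntry (pinnedChain ω₂ lam β γ) N T b b') (Ioi 0) := by
  have hN : 0 < N := by omega
  obtain ⟨hϑ0, h2ϑ⟩ := LightConeBondHeat.quarter_inv_temp_admissible hT
  rw [gkEntry_eq_of_lt (pinnedChain ω₂ lam β γ) T hb hb']
  exact pinnedChain_corr_integrableOn hω hl hβ hγ hN hT hϑ0 h2ϑ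
    (pinnedChain_continuous_bondCurrent ω₂ lam β γ N _) (pinnedChain_continuous_bondCurrent ω₂ lam β γ N _)
    (LightConeBondHeat.pinnedChain_abs_bondCurrent_le_exp hω.le hl hβ.le γ N hϑ0 _)
    (LightConeBondHeat.pinnedChain_abs_bondCurrent_le_exp hω.le hl hβ.le γ N hϑ0 _)
    (pinnedChain_integral_bondCurrent_gibbsMeasure ω₂ lam β γ N T _)

/-- **(ii), row constancy**: `∫₀^∞ M_N(b,b′) = ∫₀^∞ M_N(b,0)` for `b < N`, `b′ + 1 < N` — induction on `b′` from the
one-step identity at the interior site `b′` (`pinnedChain_integral_Ioi_gkRow_step`). [folklore] -/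
theorem pinnedChain_integral_Ioi_gkEntry_eq (hω : 0 < ω₂) (hl : 0 ≤ lam) (hβ : 0 < β) (hγ : 0 < γ) {N : ℕ} {T : ℝ}
    (hT : 0 < T) {b : ℕ} (hb : b < N) :
    ∀ b' : ℕ, b' + 1 < N →
      ∫ t in Ioi (0 : ℝ), gkEntry (pinnedChain ω₂ lam β γ) N T b b' t =
        ∫ t in Ioi (0 : ℝ), gkEntry (pinnedChain ω₂ lam β γ) N T b 0 t := by
  intro b'
  induction b' with
  | zero => intro _; rfl
  | succ k ih =>
    intro hk
    have hk' : k + 1 < N := by omega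
    rw [← ih hk', gkEntry_eq_of_lt (pinnedChain ω₂ lam β γ) T hb hk', gkEntry_eq_of_lt (pinnedChain ω₂ lam β γ) T hb
      (show k < N by omega)]
    exact (pinnedChain_integral_Ioi_gkRow_step hω hl hβ hγ hT ⟨b, hb⟩ ⟨k, by omega⟩ ⟨k + 1, hk'⟩ ⟨k + 1 + 1, hk⟩
      rfl rfl).symm

/-- **(i)**: `corr(J,J)(t) = Σ_{b<N−1} Σ_{b′<N−1} M_N(b,b′)(t)` for `N ≥ 2` (all real `t`): `μ_T(J) = 0`
(`pinnedChain_totalCurrent_gibbsMeasure`), `κ_t J = Σ_{b′} κ_t j_{b′}` pointwise (each `j_{b′}` is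
`κ_t(z,·)`-integrable, CEHR (3.4)), `∫ Σ_b Σ_{b′} j_b κ_t j_{b′} dμ_T = Σ Σ ∫` (each product is in `L¹(μ_T)`), and the
terms with `b = N−1` or `b′ = N−1` vanish (`j_{N−1} ≡ 0`). [folklore] -/
theorem pinnedChain_totalCorr_eq_sum (hω : 0 < ω₂) (hl : 0 ≤ lam) (hβ : 0 < β) (hγ : 0 < γ) {N : ℕ} (hN : 2 ≤ N)
    {T : ℝ} (hT : 0 < T) (t : ℝ) :
    totalCorr (pinnedChain ω₂ lam β γ) N T t =
      ∑ b ∈ Finset.range (N - 1), ∑ b' ∈ Finset.range (N - 1), gkEntry (pinnedChain ω₂ lam β γ) N T b b' t := by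
  set P := pinnedChain ω₂ lam β γ with hP
  set μ := P.gibbsMeasure N T with hμ
  have hN0 : 0 < N := by omega
  obtain ⟨hϑ0, h2ϑ⟩ := LightConeBondHeat.quarter_inv_temp_admissible hT
  have hϑ1 : 1 / (4 * T) < 1 / T := by linarith
  have hjc : ∀ i, Continuous (P.bondCurrent N i) := fun i => pinnedChain_continuous_bondCurrent ω₂ lam β γ N i
  have hjb := fun i => LightConeBondHeat.pinnedChain_abs_bondCurrent_le_exp hω.le hl hβ.le γ N hϑ0 i
  -- integrability facts
  have hI1 : ∀ i : Fin N, Integrable (P.bondCurrent N i) μ := fun i =>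
    (pinnedChain_isSteadyState_gibbsMeasure hω hl hβ.le γ N hT).2.2 i
  have hI2 : ∀ b : ℕ, b < N → ∀ z, Integrable (bondCurrentAt P N b) (P.transitionKernel N T T t.toNNReal z) := by
    intro b hb z
    have h1 : bondCurrentAt P N b = P.bondCurrent N ⟨b, hb⟩ := funext fun z => bondCurrentAt_eq_bondCurrent P hb z
    rw [h1]
    exact integrable_of_abs_le_exp
      (pinnedChain_integrable_exp_mul_hamiltonian_transitionKernel hω hl hT hβ.le hγ.le hN0 hϑ0 hϑ1 _ z) (hjc _) (hjb _)
  have hI3 : ∀ b b' : ℕ, b < N → b' < N →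
      Integrable (fun z => bondCurrentAt P N b z * evolve P N T (bondCurrentAt P N b') t z) μ := by
    intro b b' hb hb'
    have h1 : bondCurrentAt P N b = P.bondCurrent N ⟨b, hb⟩ := funext fun z => bondCurrentAt_eq_bondCurrent P hb z
    have h2 : bondCurrentAt P N b' = P.bondCurrent N ⟨b', hb'⟩ := funext fun z => bondCurrentAt_eq_bondCurrent P hb' z
    rw [h1, h2]
    exact pinnedChain_integrable_weight_mul_act hω hl hβ hγ hN0 hT hϑ0 h2ϑ (hjc _) (hjc _) (hjb _) (hjb _) t.toNNReal
  -- `μ_T(J) = 0`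
  have hJ0 : ∫ z, totalCurrentObs P N z ∂μ = 0 := by
    rw [← totalCurrent_eq_integral_totalCurrentObs P N μ hI1]
    exact pinnedChain_totalCurrent_gibbsMeasure ω₂ lam β γ N T
  rw [totalCorr_def, hJ0, mul_zero, sub_zero]
  -- linearity of `κ_t` and of the outer integral
  have hJ : totalCurrentObs P N = fun z => ∑ b ∈ Finset.range N, bondCurrentAt P N b z :=
    funext (totalCurrentObs_eq_sum_bondCurrentAt P N)
  have hev : ∀ z, evolve P N T (totalCurrentObs P N) t z = ∑ b ∈ Finset.range N, evolve P N T (bondCurrentAt P N b) t z := by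
    intro z
    simp only [evolve_def, hJ]
    exact integral_finsetSum _ fun b hb => hI2 b (Finset.mem_range.1 hb) z
  have hfull : ∫ z, totalCurrentObs P N z * evolve P N T (totalCurrentObs P N) t z ∂μ =
      ∑ b ∈ Finset.range N, ∑ b' ∈ Finset.range N, gkEntry P N T b b' t := by
    have hpt : ∀ z, totalCurrentObs P N z * evolve P N T (totalCurrentObs P N) t z =
        ∑ b ∈ Finset.range N, ∑ b' ∈ Finset.range N, bondCurrentAt P N b z * evolve P N T (bondCurrentAt P N b') t z := by
      intro z
      rw [hev z, totalCurrentObs_eq_sum_bondCurrentAt P N z, Finset.sum_mul_sum]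
    rw [integral_congr_ae (Eventually.of_forall hpt), integral_finsetSum _ fun b hb => ?_]
    · refine Finset.sum_congr rfl fun b hb => ?_
      rw [integral_finsetSum _ fun b' hb' => hI3 b b' (Finset.mem_range.1 hb) (Finset.mem_range.1 hb')]
      rfl
    · exact integrable_finsetSum _ fun b' hb' => hI3 b b' (Finset.mem_range.1 hb) (Finset.mem_range.1 hb')
  rw [hfull]
  -- drop the last row and column
  obtain ⟨n, rfl⟩ : ∃ n, N = n + 1 := ⟨N - 1, by omega⟩
  simp only [Nat.add_sub_cancel, Finset.sum_range_succ, gkEntry_last_right, gkEntry_last_left, Finset.sum_const_zero,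
    add_zero]

end Pinned

/-- **STUB (CF) `stub_columnFlatGreenKubo` of line `contact-current-forgetting` (crux `JunctionLocality.NonBallistic`,
stmt-AtomisticToContinuum-9127): the forward-only column flatness of the equilibrium Green–Kubo matrix of the open
pinned chain at fixed `N`.** For `T > 0`, `N ≥ 2`: (i) for `t ≥ 0`, `corr(J,J)(t) = Σ_{b<N−1} Σ_{b′<N−1} M_N(b,b′)(t)`;
(ii) for all bonds `b, b′ < N−1`: `M_N(b,b′) ∈ L¹(0,∞)` and `∫₀^∞ M_N(b,b′) = ∫₀^∞ M_N(b,0)` (no detailed balance, no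
uniqueness; see the module docstring). [folklore] -/
theorem stub_columnFlatGreenKubo :
    ∀ ω₂ lam β γ : ℝ, 0 < ω₂ → 0 < lam → 0 < β → 0 < γ → ∀ T : ℝ, 0 < T → ∀ N : ℕ, 2 ≤ N →
      (∀ t : ℝ, 0 ≤ t → totalCorr (pinnedChain ω₂ lam β γ) N T t =
        ∑ b ∈ Finset.range (N - 1), ∑ b' ∈ Finset.range (N - 1), gkEntry (pinnedChain ω₂ lam β γ) N T b b' t) ∧
      ∀ b b' : ℕ, b + 1 < N → b' + 1 < N →
        IntegrableOn (gkEntry (pinnedChain ω₂ lam β γ) N T b b') (Ioi 0) ∧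
        ∫ t in Ioi (0 : ℝ), gkEntry (pinnedChain ω₂ lam β γ) N T b b' t =
          ∫ t in Ioi (0 : ℝ), gkEntry (pinnedChain ω₂ lam β γ) N T b 0 t := by
  intro ω₂ lam β γ hω hl hβ hγ T hT N hN
  refine ⟨fun t _ => pinnedChain_totalCorr_eq_sum hω hl.le hβ hγ hN hT t, fun b b' hb hb' => ⟨?_, ?_⟩⟩
  · exact pinnedChain_integrableOn_gkEntry hω hl.le hβ hγ hT (by omega) (by omega)
  · exact pinnedChain_integral_Ioi_gkEntry_eq hω hl.le hβ hγ hT (by omega) b' hb'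

end Summit.AtomisticToContinuum.FouriersLaw.Theorems.NonBallistic

end
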